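import Mathlib
import HarnessLib

/-!
# Format C: entrywise ⇒ quadratic-form bounds (Schur test, Cauchy–Schwarz majorants, Hilbert–Schmidt)

Route context: Fourier–Galerkin / Schur-complement certificates of Weil positivity on a window ("format C";
cell memo `run/shared/lean/pub/rh-explicit/rh-explicit-weil-10/FORMATC-DESIGN.md` §4.2–4.3, §4.6, §8.2; supporting
stmt-RiemannHypothesis-0098).  The far-coercivity lemma (L-C3a) and the column-tail lemma (L-C3b) turn ENTRYWISE
bounds on explicit infinite matrices (off-diagonal digamma part `|ρ-entries| ≤ (4a/π²)/(|n−m|(n+m))`, exponential-sum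
part, tail remainders `|r_m(n) r_m(n′)| ≤ η_n η_{n′}/m^{2K+2}`) into OPERATOR bounds.  The three devices used there are
proved here once, for real matrices given as functions `E : ι → ι → ℝ` on a `Fintype` (every statement is about a
finite truncation; the user passes to the limit):

* `WeilFormatC.abs_quadForm_le_of_schurTest` — **Schur test**: `|E i j| ≤ K i j`, `K` symmetric, weights `w > 0` with
  `Σ_j K i j · w j ≤ λ · w i` for all `i` ⟹ `|Σ_{i,j} x_i E_{ij} x_j| ≤ λ Σ_i x_i²`;
* `WeilFormatC.abs_quadForm_le_diag_of_abs_le_mul` — product majorant, Schur form: `|E i j| ≤ η i · η j` (`η ≥ 0`) ⟹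
  `|Σ x_i E_ij x_j| ≤ Σ_i (η_i Σ_j η_j) x_i²` (i.e. `E ⪯ diag(η_i Σ_j η_j)`);
* `WeilFormatC.abs_quadForm_le_card_mul_of_abs_le_mul` — product majorant, Cauchy–Schwarz form:
  `|Σ x_i E_ij x_j| ≤ (Σ_i η_i |x_i|)² ≤ |ι| · Σ_i η_i² x_i²` (i.e. `E ⪯ n·diag(η²)`, the form used by PILOT-5/6/7; no sign
  condition on `η` needed);
* `WeilFormatC.sq_bilin_le_hsNormSq` — **Hilbert–Schmidt**: `(Σ_{i,j} x_i E_ij y_j)² ≤ (Σ_{i,j} E_ij²)(Σ x_i²)(Σ y_j²)`.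

Elementary real algebra (`Finset` sums); standard axioms only.
-/

-- `Summit.RiemannHypothesis.RiemannHypothesis.…` is the layout-mandated namespace (summit = problem name).
set_option linter.dupNamespace false

namespace Summit.RiemannHypothesis.RiemannHypothesis.Theorems.WeilFormatC

open Finset

variable {ι : Type*} [Fintype ι]

/-- The weighted AM–GM step of the Schur test: for `K ≥ 0`, `w_i, w_j > 0`,
`|x_i| K |x_j| ≤ ½ K (w_j/w_i · x_i² + w_i/w_j · x_j²)`. -/
theorem abs_mul_mul_abs_le_half {K wi wj xi xj : ℝ} (hK : 0 ≤ K) (hwi : 0 < wi) (hwj : 0 < wj) :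
    |xi| * K * |xj| ≤ K / 2 * (wj / wi * xi ^ 2 + wi / wj * xj ^ 2) := by
  have h0 : 0 ≤ (wj * |xi| - wi * |xj|) ^ 2 := sq_nonneg _
  have hprod : 0 < wi * wj := mul_pos hwi hwj
  have h0' : 0 ≤ wj ^ 2 * xi ^ 2 - 2 * (wi * wj) * (|xi| * |xj|) + wi ^ 2 * xj ^ 2 := by
    have e : (wj * |xi| - wi * |xj|) ^ 2
        = wj ^ 2 * |xi| ^ 2 - 2 * (wi * wj) * (|xi| * |xj|) + wi ^ 2 * |xj| ^ 2 := by ring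
    rw [e, sq_abs, sq_abs] at h0
    exact h0
  have key : 2 * (|xi| * |xj|) ≤ wj / wi * xi ^ 2 + wi / wj * xj ^ 2 := by
    rw [div_mul_eq_mul_div, div_mul_eq_mul_div, div_add_div _ _ hwi.ne' hwj.ne', le_div_iff₀ hprod]
    nlinarith [h0']
  nlinarith [key, hK]

/-- **Schur test.**  If `|E i j| ≤ K i j` with `K` symmetric and there are weights `w i > 0` with
`Σ_j K i j · w j ≤ λ · w i` for every `i`, then `|Σ_i Σ_j x_i E_{ij} x_j| ≤ λ · Σ_i x_i²`. -/
theorem abs_quadForm_le_of_schurTest (E K : ι → ι → ℝ) (w : ι → ℝ) (lam : ℝ) (x : ι → ℝ)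
    (hE : ∀ i j, |E i j| ≤ K i j) (hK : ∀ i j, K i j = K j i) (hw : ∀ i, 0 < w i)
    (hS : ∀ i, ∑ j, K i j * w j ≤ lam * w i) :
    |∑ i, ∑ j, x i * E i j * x j| ≤ lam * ∑ i, x i ^ 2 := by
  have hK0 : ∀ i j, 0 ≤ K i j := fun i j ↦ (abs_nonneg _).trans (hE i j)
  -- termwise bound
  have hterm : ∀ i j, |x i * E i j * x j| ≤ K i j / 2 * (w j / w i * x i ^ 2 + w i / w j * x j ^ 2) := by
    intro i j
    rw [abs_mul, abs_mul]
    calc |x i| * |E i j| * |x j| ≤ |x i| * K i j * |x j| := by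
          gcongr; exact hE i j
      _ ≤ _ := abs_mul_mul_abs_le_half (hK0 i j) (hw i) (hw j)
  -- sum of the termwise bounds, split into the two halves
  have h1 : |∑ i, ∑ j, x i * E i j * x j| ≤ ∑ i, ∑ j, K i j / 2 * (w j / w i * x i ^ 2 + w i / w j * x j ^ 2) := by
    refine (Finset.abs_sum_le_sum_abs _ _).trans (Finset.sum_le_sum fun i _ ↦ ?_)
    exact (Finset.abs_sum_le_sum_abs _ _).trans (Finset.sum_le_sum fun j _ ↦ hterm i j)
  refine h1.trans ?_
  have hsplit : ∑ i, ∑ j, K i j / 2 * (w j / w i * x i ^ 2 + w i / w j * x j ^ 2)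
      = (∑ i, ∑ j, K i j / 2 * (w j / w i * x i ^ 2)) + ∑ i, ∑ j, K i j / 2 * (w i / w j * x j ^ 2) := by
    rw [← Finset.sum_add_distrib]
    refine Finset.sum_congr rfl fun i _ ↦ ?_
    rw [← Finset.sum_add_distrib]
    refine Finset.sum_congr rfl fun j _ ↦ ?_
    ring
  -- the second half equals the first after swapping `i ↔ j` and using the symmetry of `K`
  have hswap : ∑ i, ∑ j, K i j / 2 * (w i / w j * x j ^ 2) = ∑ i, ∑ j, K i j / 2 * (w j / w i * x i ^ 2) := by
    rw [Finset.sum_comm]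
    refine Finset.sum_congr rfl fun i _ ↦ Finset.sum_congr rfl fun j _ ↦ ?_
    rw [hK j i]
  rw [hsplit, hswap, ← two_mul]
  -- each row: Σ_j K i j w j / w i * x i² / 2 ≤ lam x i² / 2
  have hrow : ∀ i, ∑ j, K i j / 2 * (w j / w i * x i ^ 2) ≤ lam / 2 * x i ^ 2 := by
    intro i
    have hwi := hw i
    have e : ∑ j, K i j / 2 * (w j / w i * x i ^ 2) = (∑ j, K i j * w j) * (x i ^ 2 / (2 * w i)) := by
      rw [Finset.sum_mul]
      refine Finset.sum_congr rfl fun j _ ↦ ?_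
      field_simp
    rw [e]
    have hx : 0 ≤ x i ^ 2 / (2 * w i) := by positivity
    calc (∑ j, K i j * w j) * (x i ^ 2 / (2 * w i)) ≤ lam * w i * (x i ^ 2 / (2 * w i)) :=
          mul_le_mul_of_nonneg_right (hS i) hx
      _ = lam / 2 * x i ^ 2 := by field_simp
  calc 2 * ∑ i, ∑ j, K i j / 2 * (w j / w i * x i ^ 2) ≤ 2 * ∑ i, lam / 2 * x i ^ 2 := by
        gcongr with i; exact hrow i
    _ = lam * ∑ i, x i ^ 2 := by rw [Finset.mul_sum, Finset.mul_sum]; refine Finset.sum_congr rfl fun i _ ↦ by ring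

/-- **Product majorant, Schur form.**  If `|E i j| ≤ η i · η j` with `η ≥ 0` then
`|Σ_i Σ_j x_i E_ij x_j| ≤ Σ_i (η_i · Σ_j η_j) · x_i²`, i.e. `E ⪯ diag(η_i Σ_j η_j)` as quadratic forms
(`|x_i||x_j| η_i η_j ≤ ½ η_i η_j (x_i² + x_j²)`). -/
theorem abs_quadForm_le_diag_of_abs_le_mul (E : ι → ι → ℝ) (η x : ι → ℝ) (hη : ∀ i, 0 ≤ η i)
    (hE : ∀ i j, |E i j| ≤ η i * η j) :
    |∑ i, ∑ j, x i * E i j * x j| ≤ ∑ i, (η i * ∑ j, η j) * x i ^ 2 := by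
  have hterm : ∀ i j, |x i * E i j * x j| ≤ η i * η j / 2 * (x i ^ 2 + x j ^ 2) := by
    intro i j
    rw [abs_mul, abs_mul]
    have h1 : |x i| * |E i j| * |x j| ≤ |x i| * (η i * η j) * |x j| := by gcongr; exact hE i j
    refine h1.trans ?_
    have h0 : 0 ≤ (|x i| - |x j|) ^ 2 := sq_nonneg _
    have hp : 0 ≤ η i * η j := mul_nonneg (hη i) (hη j)
    nlinarith [sq_abs (x i), sq_abs (x j), h0, hp]
  have h1 : |∑ i, ∑ j, x i * E i j * x j| ≤ ∑ i, ∑ j, η i * η j / 2 * (x i ^ 2 + x j ^ 2) := by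
    refine (Finset.abs_sum_le_sum_abs _ _).trans (Finset.sum_le_sum fun i _ ↦ ?_)
    exact (Finset.abs_sum_le_sum_abs _ _).trans (Finset.sum_le_sum fun j _ ↦ hterm i j)
  refine h1.trans (le_of_eq ?_)
  have hsplit : ∑ i, ∑ j, η i * η j / 2 * (x i ^ 2 + x j ^ 2)
      = (∑ i, ∑ j, η i * η j / 2 * x i ^ 2) + ∑ i, ∑ j, η i * η j / 2 * x j ^ 2 := by
    rw [← Finset.sum_add_distrib]
    refine Finset.sum_congr rfl fun i _ ↦ ?_
    rw [← Finset.sum_add_distrib]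
    refine Finset.sum_congr rfl fun j _ ↦ by ring
  have hswap : ∑ i, ∑ j, η i * η j / 2 * x j ^ 2 = ∑ i, ∑ j, η i * η j / 2 * x i ^ 2 := by
    rw [Finset.sum_comm]
    refine Finset.sum_congr rfl fun i _ ↦ Finset.sum_congr rfl fun j _ ↦ by ring
  rw [hsplit, hswap, ← two_mul, Finset.mul_sum]
  refine Finset.sum_congr rfl fun i _ ↦ ?_
  rw [Finset.mul_sum, Finset.mul_sum, Finset.sum_mul]
  refine Finset.sum_congr rfl fun j _ ↦ by ring

/-- **Product majorant, Cauchy–Schwarz form.**  If `|E i j| ≤ η i · η j` then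
`|Σ_i Σ_j x_i E_ij x_j| ≤ (Σ_i η_i |x_i|)²`. -/
theorem abs_quadForm_le_sq_sum_of_abs_le_mul (E : ι → ι → ℝ) (η x : ι → ℝ)
    (hE : ∀ i j, |E i j| ≤ η i * η j) :
    |∑ i, ∑ j, x i * E i j * x j| ≤ (∑ i, η i * |x i|) ^ 2 := by
  have hterm : ∀ i j, |x i * E i j * x j| ≤ (η i * |x i|) * (η j * |x j|) := by
    intro i j
    rw [abs_mul, abs_mul]
    have h1 : |x i| * |E i j| * |x j| ≤ |x i| * (η i * η j) * |x j| := by gcongr; exact hE i j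
    linarith [h1]
  calc |∑ i, ∑ j, x i * E i j * x j| ≤ ∑ i, ∑ j, (η i * |x i|) * (η j * |x j|) := by
        refine (Finset.abs_sum_le_sum_abs _ _).trans (Finset.sum_le_sum fun i _ ↦ ?_)
        exact (Finset.abs_sum_le_sum_abs _ _).trans (Finset.sum_le_sum fun j _ ↦ hterm i j)
    _ = (∑ i, η i * |x i|) ^ 2 := by
        rw [sq, Finset.sum_mul_sum]

/-- The Cauchy–Schwarz majorant in diagonal form: `(Σ_i η_i |x_i|)² ≤ |ι| · Σ_i η_i² x_i²`, hence under
`|E i j| ≤ η i η j`: `|Σ x_i E_ij x_j| ≤ |ι| · Σ η_i² x_i²` — `E ⪯ n·diag(η²)`, the remainder-matrix bound of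
FORMATC-DESIGN §4.6/§8.2. -/
theorem abs_quadForm_le_card_mul_of_abs_le_mul (E : ι → ι → ℝ) (η x : ι → ℝ)
    (hE : ∀ i j, |E i j| ≤ η i * η j) :
    |∑ i, ∑ j, x i * E i j * x j| ≤ Fintype.card ι * ∑ i, η i ^ 2 * x i ^ 2 := by
  refine (abs_quadForm_le_sq_sum_of_abs_le_mul E η x hE).trans ?_
  have hcs := Finset.sum_mul_sq_le_sq_mul_sq (Finset.univ : Finset ι) (fun _ ↦ (1 : ℝ)) (fun i ↦ η i * |x i|)
  simp only [one_mul, one_pow, Finset.sum_const, Finset.card_univ, nsmul_eq_mul, mul_one] at hcs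
  refine hcs.trans (le_of_eq ?_)
  congr 1
  refine Finset.sum_congr rfl fun i _ ↦ ?_
  rw [mul_pow, sq_abs]

/-- **Hilbert–Schmidt bound** for a bilinear form: `(Σ_i Σ_j x_i E_ij y_j)² ≤ (Σ_i Σ_j E_ij²)·(Σ_i x_i²)·(Σ_j y_j²)`. -/
theorem sq_bilin_le_hsNormSq {κ : Type*} [Fintype κ] (E : ι → κ → ℝ) (x : ι → ℝ) (y : κ → ℝ) :
    (∑ i, ∑ j, x i * E i j * y j) ^ 2 ≤ (∑ i, ∑ j, E i j ^ 2) * (∑ i, x i ^ 2) * (∑ j, y j ^ 2) := by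
  -- inner Cauchy–Schwarz in `j` for each `i`, then outer Cauchy–Schwarz in `i`
  have hin : ∀ i, (∑ j, E i j * y j) ^ 2 ≤ (∑ j, E i j ^ 2) * ∑ j, y j ^ 2 :=
    fun i ↦ Finset.sum_mul_sq_le_sq_mul_sq _ _ _
  have e1 : ∑ i, ∑ j, x i * E i j * y j = ∑ i, x i * ∑ j, E i j * y j := by
    refine Finset.sum_congr rfl fun i _ ↦ ?_
    rw [Finset.mul_sum]
    refine Finset.sum_congr rfl fun j _ ↦ by ring
  rw [e1]
  have hout := Finset.sum_mul_sq_le_sq_mul_sq (Finset.univ : Finset ι) x (fun i ↦ ∑ j, E i j * y j)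
  refine hout.trans ?_
  have h2 : ∑ i, (∑ j, E i j * y j) ^ 2 ≤ ∑ i, (∑ j, E i j ^ 2) * ∑ j, y j ^ 2 :=
    Finset.sum_le_sum fun i _ ↦ hin i
  rw [← Finset.sum_mul] at h2
  have hx : 0 ≤ ∑ i, x i ^ 2 := Finset.sum_nonneg fun i _ ↦ sq_nonneg _
  calc (∑ i, x i ^ 2) * ∑ i, (∑ j, E i j * y j) ^ 2
      ≤ (∑ i, x i ^ 2) * ((∑ i, ∑ j, E i j ^ 2) * ∑ j, y j ^ 2) := mul_le_mul_of_nonneg_left h2 hx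
    _ = (∑ i, ∑ j, E i j ^ 2) * (∑ i, x i ^ 2) * (∑ j, y j ^ 2) := by ring

end Summit.RiemannHypothesis.RiemannHypothesis.Theorems.WeilFormatC
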